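import Summits.Parity.GeneralizedHardyLittlewood.Theorems.LeeYangFibresRelativeDimOneMoebiusSplitTermBoundAux5
import Mathlib
import HarnessLib

/-!
# Route `LeeYangFibres`, crux `RelativeDimOne` (stmt-Parity-14113), line `single-moebius-split`:
# stub `stub_termExpansion` (S1-D) — expansion of term `j ≥ 1` into single-Möbius class sums

For levels `R_i = N^{δ_i}` (`δ_i > 0`, `∑ δ_i ≤ 1/4`) and `N ≥ N₀(k, L, δ)`:

`|telescopeTermSum Ψ K N R j| ≤ N^{1/2} + (log N)^k ∑_{e ≤ 2LN} ∑_d |Σ(d, e)|`,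

`Σ(d, e) = termClassSum Ψ K N R_j j d e` (`TermExpansionBound k j`). The combinatorial skeleton is
isolated in `texp_abstract` (restrict to the positivity region, split off the at most one point with
`ψ_j(n) = 1`, expand the remaining summands, swap the sums, bound the tuple weights); `texp_core`
instantiates it with the pointwise facts of the auxiliary file
`…MoebiusSplitTermBoundAux5` (`texp_summand_eq_zero`, `texp_summand_expand`, `texp_classSum_eq`,
`texp_eval_injective`), and `stub_termExpansion` chooses `N₀ = max(N₁, 3, 2L)` with
`2^k (log N)^{2k+1} ≤ N^{1/4}` for `N ≥ N₁` (`texp_eventually_log_pow_le`, `texp_exceptional_le`).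
-/

noncomputable section

open scoped BigOperators Classical
open Filter Finset Literature.NumberTheory.Sieve

namespace Summit.Parity.GeneralizedHardyLittlewood.Cruxes.RelativeDimOne.SingleMoebiusSplit

/-! ### Two pieces of finite-sum algebra -/

/-- Swapping the sums: `∑_n (−∑_e ∑_d w(d) g(n,d,e)) = −∑_e ∑_d w(d) ∑_n g(n,d,e)`. -/
theorem texp_swap {α β γ : Type*} (S : Finset α) (E : Finset β) (D : Finset γ) (w : γ → ℝ)
    (g : α → γ → β → ℝ) :
    ∑ n ∈ S, (-∑ e ∈ E, ∑ d ∈ D, w d * g n d e) =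
      -∑ e ∈ E, ∑ d ∈ D, w d * ∑ n ∈ S, g n d e := by
  rw [Finset.sum_neg_distrib, Finset.sum_comm]
  refine congrArg Neg.neg (Finset.sum_congr rfl fun e _ => ?_)
  rw [Finset.sum_comm]
  refine Finset.sum_congr rfl fun d _ => ?_
  rw [Finset.mul_sum]

/-- Bounding a weighted double sum by the sup of the weights: `|∑_e ∑_d w(d) c(d,e)| ≤ W ∑_e ∑_d |c(d,e)|`
for `|w(d)| ≤ W`. -/
theorem texp_abs_double_sum_le {β γ : Type*} (E : Finset β) (D : Finset γ) (w : γ → ℝ)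
    (c : γ → β → ℝ) {W : ℝ} (hW : ∀ d ∈ D, |w d| ≤ W) :
    |∑ e ∈ E, ∑ d ∈ D, w d * c d e| ≤ W * ∑ e ∈ E, ∑ d ∈ D, |c d e| := by
  rw [Finset.mul_sum]
  refine (Finset.abs_sum_le_sum_abs _ _).trans (Finset.sum_le_sum fun e _ => ?_)
  rw [Finset.mul_sum]
  refine (Finset.abs_sum_le_sum_abs _ _).trans (Finset.sum_le_sum fun d hd => ?_)
  rw [abs_mul]
  exact mul_le_mul_of_nonneg_right (hW d hd) (abs_nonneg _)

/-! ### The combinatorial skeleton of the expansion -/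

/-- **The skeleton of the expansion.** For a sum `∑_{n ∈ I, P₀ n} F(n)` such that `F` vanishes off
`Ppos`, the value `v(n) = 1` is taken at most once on `I` with `|F(n)| ≤ B` there, and on
`P₀ ∧ Ppos ∧ v ≠ 1` the summand expands as `F(n) = −∑_e ∑_d w(d) g(n,d,e)` with `|w(d)| ≤ W` and
`n`-sums `∑ g(·,d,e) = Σ(d,e)`: `|∑_{n ∈ I, P₀ n} F(n)| ≤ B + W ∑_e ∑_d |Σ(d,e)|`. -/
theorem texp_abstract {γ : Type*} (I : Finset ℤ) (P₀ : ℤ → Prop) [DecidablePred P₀]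
    (Ppos : ℤ → Prop) (v : ℤ → ℤ) (F : ℤ → ℝ) (E : Finset ℕ) (D : Finset γ) (w : γ → ℝ)
    (g : ℤ → γ → ℕ → ℝ) (Sg : γ → ℕ → ℝ) {B W : ℝ}
    (hvanish : ∀ n ∈ I, P₀ n → ¬ Ppos n → F n = 0)
    (hexpand : ∀ n ∈ I, P₀ n → Ppos n → v n ≠ 1 → F n = -∑ e ∈ E, ∑ d ∈ D, w d * g n d e)
    (hclass : ∀ d ∈ D, ∀ e ∈ E, ∀ S' : Finset ℤ,
      (∀ n, n ∈ S' ↔ n ∈ I ∧ P₀ n ∧ Ppos n ∧ v n ≠ 1) → ∑ n ∈ S', g n d e = Sg d e)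
    (hinj : ∀ n ∈ I, ∀ n' ∈ I, v n = 1 → v n' = 1 → n = n')
    (hB0 : 0 ≤ B) (hB : ∀ n ∈ I, v n = 1 → |F n| ≤ B) (hW : ∀ d ∈ D, |w d| ≤ W) :
    |∑ n ∈ I.filter P₀, F n| ≤ B + W * ∑ e ∈ E, ∑ d ∈ D, |Sg d e| := by
  set S := (I.filter P₀).filter Ppos with hS
  have hmemS : ∀ n, n ∈ S → n ∈ I ∧ P₀ n ∧ Ppos n := fun n hn => by
    simp only [hS, Finset.mem_filter] at hn
    exact ⟨hn.1.1, hn.1.2, hn.2⟩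
  -- restrict to the positivity region
  have h1 : ∑ n ∈ I.filter P₀, F n = ∑ n ∈ S, F n := by
    rw [hS]
    refine (Finset.sum_filter_of_ne fun n hn hne => ?_).symm
    by_contra h
    exact hne (hvanish n (Finset.mem_filter.mp hn).1 (Finset.mem_filter.mp hn).2 h)
  -- the exceptional point
  have hT1 : |∑ n ∈ S.filter (fun n => v n = 1), F n| ≤ B := by
    have hc : (S.filter (fun n => v n = 1)).card ≤ 1 := by
      refine Finset.card_le_one.mpr fun n hn n' hn' => ?_
      rw [Finset.mem_filter] at hn hn'
      exact hinj n (hmemS n hn.1).1 n' (hmemS n' hn'.1).1 hn.2 hn'.2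
    refine (Finset.abs_sum_le_sum_abs _ _).trans ?_
    calc ∑ n ∈ S.filter (fun n => v n = 1), |F n| ≤ (S.filter (fun n => v n = 1)).card • B :=
          Finset.sum_le_card_nsmul _ _ _ fun n hn => by
            rw [Finset.mem_filter] at hn
            exact hB n (hmemS n hn.1).1 hn.2
      _ ≤ 1 • B := nsmul_le_nsmul_left hB0 hc
      _ = B := one_nsmul B
  -- the expanded part
  have hT2 : |∑ n ∈ S.filter (fun n => ¬ v n = 1), F n| ≤ W * ∑ e ∈ E, ∑ d ∈ D, |Sg d e| := by
    have hmem2 : ∀ n, n ∈ S.filter (fun n => ¬ v n = 1) ↔ n ∈ I ∧ P₀ n ∧ Ppos n ∧ v n ≠ 1 := by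
      intro n
      simp only [hS, Finset.mem_filter, and_assoc, ne_eq]
    have heq : ∑ n ∈ S.filter (fun n => ¬ v n = 1), F n = -∑ e ∈ E, ∑ d ∈ D, w d * Sg d e := by
      calc ∑ n ∈ S.filter (fun n => ¬ v n = 1), F n
          = ∑ n ∈ S.filter (fun n => ¬ v n = 1), (-∑ e ∈ E, ∑ d ∈ D, w d * g n d e) :=
            Finset.sum_congr rfl fun n hn => by
              obtain ⟨hnI, hP, hPp, hne⟩ := (hmem2 n).mp hn
              exact hexpand n hnI hP hPp hne
        _ = -∑ e ∈ E, ∑ d ∈ D, w d * ∑ n ∈ S.filter (fun n => ¬ v n = 1), g n d e :=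
            texp_swap _ _ _ _ _
        _ = -∑ e ∈ E, ∑ d ∈ D, w d * Sg d e := by
            refine congrArg Neg.neg (Finset.sum_congr rfl fun e he =>
              Finset.sum_congr rfl fun d hd => ?_)
            rw [hclass d hd e he _ hmem2]
    rw [heq, abs_neg]
    exact texp_abs_double_sum_le E D w Sg hW
  rw [h1, ← Finset.sum_filter_add_sum_filter_not S (fun n => v n = 1) F]
  exact (abs_add_le _ _).trans (add_le_add hT1 hT2)

/-! ### The expansion for general levels -/

/-- **The expansion of term `j` for general levels `R_i ≥ 1`.** If `|F(n)| ≤ B` (`B ≥ 0`) at the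
points of the box with `ψ_j(n) = 1` and the tuple weights are `≤ W` in absolute value, then
`|telescopeTermSum Ψ K N R j| ≤ B + W ∑_{e ≤ 2LN} ∑_d |termClassSum Ψ K N R_j j d e|`. -/
theorem texp_core {k : ℕ} (j : Fin (k + 1)) {N L : ℕ} (hN : 1 ≤ N) {Ψ : Fin (k + 1) → AffLinForm 1}
    (hΨ : IsNondegenerateSystem Ψ) (hL : affLinSize Ψ N ≤ L) (K : Set (Fin 1 → ℝ))
    {R : Fin (k + 1) → ℝ} (hR : ∀ i, 1 ≤ R i) {B W : ℝ} (hB0 : 0 ≤ B)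
    (hB : ∀ n ∈ Finset.Icc (-(N : ℤ)) N, (Ψ j).eval (fun _ => n) = 1 →
      |(∏ i ∈ Finset.Iio j, intVonMangoldt ((Ψ i).eval (fun _ => n))) *
          (intVonMangoldt ((Ψ j).eval (fun _ => n)) - lambdaR (R j) ((Ψ j).eval (fun _ => n))) *
          ∏ i ∈ Finset.Ioi j, lambdaR (R i) ((Ψ i).eval (fun _ => n))| ≤ B)
    (hW : ∀ d ∈ Fintype.piFinset (fun i => if i ∈ Finset.Ioi j then Finset.Icc 1 ⌊R i⌋₊ else {1}),
      |∏ i ∈ Finset.Ioi j, (((ArithmeticFunction.moebius (d i) : ℤ) : ℝ) *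
        Real.log (R i / d i))| ≤ W) :
    |telescopeTermSum Ψ K N R j| ≤
      B + W * ∑ e ∈ Finset.Icc 1 (2 * L * N),
        ∑ d ∈ Fintype.piFinset (fun i => if i ∈ Finset.Ioi j then Finset.Icc 1 ⌊R i⌋₊ else {1}),
          |termClassSum Ψ K N (R j) j d e| := by
  have hR0 : ∀ i, 0 ≤ R i := fun i => zero_le_one.trans (hR i)
  have hRj0 : 0 < R j := zero_lt_one.trans_le (hR j)
  rw [texp_telescopeTermSum_eq_sum_Icc]
  refine texp_abstract (Finset.Icc (-(N : ℤ)) N) (fun n : ℤ => (fun _ : Fin 1 => (n : ℝ)) ∈ K)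
    (fun n : ℤ => ∀ i, 0 < (Ψ i).eval (fun _ => n)) (fun n : ℤ => (Ψ j).eval (fun _ => n))
    (fun n : ℤ => (∏ i ∈ Finset.Iio j, intVonMangoldt ((Ψ i).eval (fun _ => n))) *
      (intVonMangoldt ((Ψ j).eval (fun _ => n)) - lambdaR (R j) ((Ψ j).eval (fun _ => n))) *
      ∏ i ∈ Finset.Ioi j, lambdaR (R i) ((Ψ i).eval (fun _ => n)))
    (Finset.Icc 1 (2 * L * N))
    (Fintype.piFinset (fun i => if i ∈ Finset.Ioi j then Finset.Icc 1 ⌊R i⌋₊ else {1}))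
    (fun d => ∏ i ∈ Finset.Ioi j, (((ArithmeticFunction.moebius (d i) : ℤ) : ℝ) *
      Real.log (R i / d i)))
    (fun n d e => if ((e : ℤ) ∣ (Ψ j).eval (fun _ => n) ∧
          R j * e < (((Ψ j).eval (fun _ => n) : ℤ) : ℝ) ∧
          ∀ i ∈ Finset.Ioi j, (0 < (Ψ i).eval (fun _ => n) ∧
            ((d i : ℕ) : ℤ) ∣ (Ψ i).eval (fun _ => n)))
        then (ArithmeticFunction.moebius (((Ψ j).eval (fun _ => n)) / e).toNat : ℝ) *
            Real.log ((((Ψ j).eval (fun _ => n) : ℤ) : ℝ) / (e * R j)) *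
            ∏ i ∈ Finset.Iio j, intVonMangoldt ((Ψ i).eval (fun _ => n))
        else 0)
    (fun d e => termClassSum Ψ K N (R j) j d e) ?_ ?_ ?_ ?_ hB0 hB hW
  · -- vanishing off the positivity region
    intro n _ _ h
    exact texp_summand_eq_zero j R Ψ n h
  · -- pointwise expansion for `ψ_j(n) ≥ 2`
    intro n hn _ hpos hne
    have hposj : 0 < (Ψ j).eval (fun _ => n) := hpos j
    have hne' : (Ψ j).eval (fun _ => n) ≠ 1 := hne
    have h2 : 2 ≤ (Ψ j).eval (fun _ => n) := by omega
    have hE : (((Ψ j).eval (fun _ => n) : ℤ) : ℝ) ≤ R j * ((2 * L * N : ℕ) : ℝ) := by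
      have h := (le_abs_self _).trans (texp_abs_eval_le hN hL hn j)
      push_cast
      calc _ ≤ 2 * (L : ℝ) * N := h
        _ = 1 * (2 * L * N) := (one_mul _).symm
        _ ≤ R j * (2 * L * N) := mul_le_mul_of_nonneg_right (hR j) (by positivity)
    exact texp_summand_expand k j R hR0 hRj0 (2 * L * N) Ψ n h2 hE
  · -- the class sums
    intro d _ e he S' hS'
    exact texp_classSum_eq Ψ K N (hR j) j d (Finset.mem_Icc.mp he).1 hS'
  · -- `ψ_j(n) = 1` at most once
    intro n _ n' _ h h'
    have h1 : (Ψ j).eval (fun _ => n) = 1 := h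
    have h1' : (Ψ j).eval (fun _ => n') = 1 := h'
    exact texp_eval_injective hΨ j (h1.trans h1'.symm)

/-! ### The stub -/

/-- **S1-D `stub_termExpansion` (registered stub of the line `single-moebius-split`).** For levels
`R_i = N^{δ_i}` (`δ_i > 0`, `∑ δ_i ≤ 1/4`) and `N ≥ N₀(k, L, δ)`:
`|telescopeTermSum Ψ K N R j| ≤ N^{1/2} + (log N)^k ∑_{e ≤ 2LN} ∑_d |termClassSum Ψ K N R_j j d e|`,
uniformly over non-degenerate `Ψ` with `‖Ψ‖_N ≤ L` and all `K` (convexity and `K ⊆ [−N, N]` are not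
used; nor is `j ≠ 0`). -/
theorem stub_termExpansion : ∀ (k : ℕ) (j : Fin (k + 1)), j ≠ 0 → TermExpansionBound k j := by
  intro k j _ L δ hδ hsum
  obtain ⟨N₁, hN₁⟩ := Filter.eventually_atTop.mp (texp_eventually_log_pow_le k)
  refine ⟨max N₁ (max 3 (2 * L)), fun N hN Ψ hΨ hL K _ _ => ?_⟩
  have hNN₁ : N₁ ≤ N := le_of_max_le_left hN
  have hN3 : 3 ≤ N := le_of_max_le_left (le_of_max_le_right hN)
  have h2L : 2 * L ≤ N := le_of_max_le_right (le_of_max_le_right hN)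
  have hL1 : 1 ≤ L := texp_one_le_of_affLinSize_le hΨ hL
  have hN1 : (1 : ℝ) ≤ N := by exact_mod_cast (show 1 ≤ N by omega)
  have hR : ∀ i, (1 : ℝ) ≤ (N : ℝ) ^ (δ i) := fun i => Real.one_le_rpow hN1 (hδ i).le
  obtain ⟨hB0, hBle⟩ := texp_exceptional_le (k := k) hN3 hL1 h2L (hN₁ N hNN₁)
  refine (texp_core j (by omega) hΨ hL K (R := fun i => (N : ℝ) ^ (δ i)) hR hB0
    (fun n hn h1 => texp_abs_summand_one_le j hN3 hL1 hL hδ hsum hn h1)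
    (fun d hd => texp_abs_wt_le hN3 hδ hsum j hd)).trans ?_
  exact add_le_add hBle le_rfl

end Summit.Parity.GeneralizedHardyLittlewood.Cruxes.RelativeDimOne.SingleMoebiusSplit
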